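import Summits.MatrixMultiplication.MatrixMultiplication.Theorems.FarEdgeDescentSignTwistCommPow
import HarnessLib

/-!
# The one-parameter same-support family `𝔖(q)` of `⟨2,2,2⟩`: only `q = 1` is reached from `⟨2,2,2⟩`

Route `FarEdgeDescent` (cell `decomp-mm`, lens 2 «structural dichotomy (special vs generic)»,
gen 32), Kernel VII; support for the aside `SubLogRate` (stmt-MatrixMultiplication-25371).

Bläser–Christandl–Zuiddam (2017, §2): every tensor with the support of `⟨2,2,2⟩` is, up to the
torus `(T₄)³`, the tensor `⟨2,2,2⟩` with all non-zero entries `1` except possibly ONE.  In the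
two-leaf coordinates of this route that normal form is the weighted star
`𝔖(q) = weightedStar K 2 1 (famW q) : (X; y, y') ↦ (Xy, X^{(q)} y')`, `X^{(q)}` = `X` with the
entry `x₁₀` multiplied by `q`; `𝔖(1) ≅ ⟨2,2,2⟩` (`fam_one`) and `𝔖(-1) = 𝔖^♭` is the sign star
(`fam_neg_one`).  The special-vs-generic dichotomy on this family, over EVERY field:

* `comm_fam`: for `q ≠ 0, 1` the `x`-pencil commutant of `𝔖(q)` — the pairs `(β, γ)` with
  `β · 𝔖(q)(x) = 𝔖(q)(x) · γ` for all four slices — consists of the block scalars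
  `(μ₀ 1 ⊕ μ₁ 1, μ₀ 1 ⊕ μ₁ 1)` only (dimension `≤ 2`), whereas at `q = 1` it contains the four
  independent operators `E_{pq} ⊗ 1` (`hcomm₀`, `β₀_linearIndependent`);
* `matMul_not_algDegeneratesTo_fam`: hence **`⟨2,2,2⟩ ⋭ 𝔖(q)` for every `q ∉ {0, 1}` over every
  field** (BCS (15.19): the commutant only grows under degeneration) — the WHOLE normal-form
  family minus the coherent point is unreachable from `⟨2,2,2⟩`, although every member has the
  same support and the same flattening ranks `(4,4,4)`, and over `ℂ` the same border rank `7`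
  (BCZ17, Thm. 2).  The point `q = -1` is Kernel VII's edge `⟨2,2,2⟩ ⋭ 𝔖^♭`, obtained in
  `FarEdgeDescentSignTwistDet` from the permutation model `𝔖^♭ ≅ 𝔖_{T_rd}` over an INFINITE
  field of characteristic `≠ 2`; the present proof is uniform in `q`, works over finite fields
  too, and uses characteristic `≠ 2` only to have `-1 ≠ 1`
  (`matMul_not_algDegeneratesTo_signStar_of_two_ne_zero`).  In characteristic `2` the family
  still has unreachable members as soon as `|K| > 2`.

References: M. Bläser, M. Christandl, J. Zuiddam, *The border support rank of two-by-two matrix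
multiplication is seven*, Chicago J. Theoret. Comput. Sci. 2018 (arXiv:1705.09652), §2
[BlaserChristandlZuiddam2017]; P. Bürgisser, M. Clausen, M. A. Shokrollahi, *Algebraic Complexity
Theory* (1997), (15.19), §20.2 [BurgisserClausenShokrollahi1997].
-/

noncomputable section

open scoped BigOperators Matrix

set_option linter.dupNamespace false

namespace Summit.MatrixMultiplication.MatrixMultiplication.Theorems.FarEdgeDescentWeightFamily

open Literature.Computability.AlgebraicComplexity
open Summit.MatrixMultiplication.MatrixMultiplication.Theorems.FarEdgeDescentCommutantObstruction
open Summit.MatrixMultiplication.MatrixMultiplication.Theorems.FarEdgeDescentTwistRigidity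
open Summit.MatrixMultiplication.MatrixMultiplication.Theorems.FarEdgeDescentSignTwist
open Summit.MatrixMultiplication.MatrixMultiplication.Theorems.FarEdgeDescentSignTwistDet
open Summit.MatrixMultiplication.MatrixMultiplication.Theorems.FarEdgeDescentSignTwistComm
open Summit.MatrixMultiplication.MatrixMultiplication.Theorems.FarEdgeDescentSignTwistCommPow

universe u

variable (K : Type u) [Field K]

/-! ## The family -/

/-- The weight table of `𝔖(q)`: `q` at `x = (1,0)`, `1` elsewhere. [folklore] -/
def famW (q : K) (x : Fin 2 × Fin 2) : K := if x = (1, 0) then q else 1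

/-- **`𝔖(q)`**: the BCZ normal form of the same-support class of `⟨2,2,2⟩` in leaf coordinates.
[cite: BlaserChristandlZuiddam2017, §2] -/
abbrev fam (q : K) : Leaf2 → (Fin 2 × Fin 2) → Leaf2 → K := weightedStar K 2 1 (famW K q)

/-- `𝔖(-1)` is the sign star `𝔖^♭`. [folklore] -/
theorem fam_neg_one : fam K (-1) = signStar K := rfl

/-- `𝔖(1)` is the coherent star `𝔖_1 ≅ ⟨2,2,2⟩`. [folklore] -/
theorem fam_one : fam K 1 = permStar K 2 1 (Equiv.refl _) := by
  rw [fam, show famW K 1 = fun _ => 1 from funext fun x => by simp [famW], weightedStar_one]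

/-- The leaf with side `σ` and row `r`. [folklore] -/
def mkLeaf (σ r : Fin 2) : Leaf2 := if σ = 0 then Sum.inl (r, 0) else Sum.inr (r, 0)

/-- The weight seen on side `σ`: `famW q` on the right leaf, `1` on the left. [folklore] -/
def wS (q : K) (σ : Fin 2) (x : Fin 2 × Fin 2) : K := if σ = 1 then famW K q x else 1

/-- The weights do not vanish (`q ≠ 0`). [folklore] -/
theorem wS_ne_zero {q : K} (hq : q ≠ 0) (σ : Fin 2) (x : Fin 2 × Fin 2) : wS K q σ x ≠ 0 := by
  unfold wS famW; split_ifs <;> simp [hq]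

/-- Closed form of `𝔖(q)`. [folklore] -/
theorem fam_apply (q : K) (a : Leaf2) (x : Fin 2 × Fin 2) (c : Leaf2) :
    fam K q a x c = if side a = side c ∧ x = (row a, row c) then wS K q (side a) x else 0 := by
  obtain ⟨x₁, x₂⟩ := x
  rcases a with ⟨r, l⟩ | ⟨r, l⟩ <;> rcases c with ⟨k, l'⟩ | ⟨k, l'⟩ <;> fin_cases l <;> fin_cases l'
  · fin_cases r <;> fin_cases k <;> fin_cases x₁ <;> fin_cases x₂ <;>
      simp [matMulTensor, side, row, wS]
  · simp [side]
  · simp [side]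
  · fin_cases r <;> fin_cases k <;> fin_cases x₁ <;> fin_cases x₂ <;>
      simp [matMulTensor, side, row, wS, famW]

/-! ## The two slice products -/

variable {K}

/-- `(M · 𝔖(q)(x))(a,c) = [row c = x₂] · w_{side c}(x) · M(a, leaf(side c, x₁))`. [folklore] -/
theorem mul_slice (q : K) (M : Matrix Leaf2 Leaf2 K) (x : Fin 2 × Fin 2) (a c : Leaf2) :
    (M * slice (fam K q) x) a c =
      if row c = x.2 then wS K q (side c) x * M a (mkLeaf (side c) x.1) else 0 := by
  simp only [Matrix.mul_apply, slice, Matrix.of_apply, fam_apply, Fintype.sum_sum_type,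
    Fintype.sum_prod_type, Fin.sum_univ_two, Fin.sum_univ_one]
  obtain ⟨x₁, x₂⟩ := x
  rcases c with ⟨k, l⟩ | ⟨k, l⟩ <;> fin_cases l <;> fin_cases k <;> fin_cases x₁ <;>
    fin_cases x₂ <;> simp [side, row, mkLeaf, wS, famW, mul_comm]

/-- `(𝔖(q)(x) · M)(a,c) = [row a = x₁] · w_{side a}(x) · M(leaf(side a, x₂), c)`. [folklore] -/
theorem slice_mul (q : K) (M : Matrix Leaf2 Leaf2 K) (x : Fin 2 × Fin 2) (a c : Leaf2) :
    (slice (fam K q) x * M) a c =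
      if row a = x.1 then wS K q (side a) x * M (mkLeaf (side a) x.2) c else 0 := by
  simp only [Matrix.mul_apply, slice, Matrix.of_apply, fam_apply, Fintype.sum_sum_type,
    Fintype.sum_prod_type, Fin.sum_univ_two, Fin.sum_univ_one]
  obtain ⟨x₁, x₂⟩ := x
  rcases a with ⟨r, l⟩ | ⟨r, l⟩ <;> fin_cases l <;> fin_cases r <;> fin_cases x₁ <;>
    fin_cases x₂ <;> simp [side, row, mkLeaf, wS, famW]

/-! ## The coherent point `q = 1`: four independent commuting operators -/

variable (K)

/-- `β₀(p,q) = E_{pq} ⊗ 1`: moves side `q` to side `p`, rows fixed. [folklore] -/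
def β₀ (r : Fin 2 × Fin 2) : Matrix Leaf2 Leaf2 K :=
  Matrix.of fun a d => if side a = r.1 ∧ side d = r.2 ∧ row a = row d then 1 else 0

/-- `wS 1 = 1`. [folklore] -/
@[simp] theorem wS_one (σ : Fin 2) (x : Fin 2 × Fin 2) : wS K 1 σ x = 1 := by
  simp [wS, famW]

/-- `side (mkLeaf σ r) = σ`. [folklore] -/
@[simp] theorem side_mkLeaf (σ r : Fin 2) : side (mkLeaf σ r) = σ := by
  fin_cases σ <;> rfl

/-- `row (mkLeaf σ r) = r`. [folklore] -/
@[simp] theorem row_mkLeaf (σ r : Fin 2) : row (mkLeaf σ r) = r := by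
  fin_cases σ <;> rfl

/-- **The four operators commute with the slices of `𝔖(1)`.**
[cite: BurgisserClausenShokrollahi1997, (15.19)] -/
theorem hcomm₀ (r : Fin 2 × Fin 2) (x : Fin 2 × Fin 2) :
    β₀ K r * slice (fam K 1) x = slice (fam K 1) x * β₀ K r := by
  ext a c
  rw [mul_slice, slice_mul]
  simp only [β₀, Matrix.of_apply, side_mkLeaf, row_mkLeaf, wS_one, one_mul]
  by_cases h1 : row c = x.2 <;> by_cases h2 : row a = x.1
  · simp [h1, h2]
  · simp [h1, h2]
  · have h1' : ¬ x.2 = row c := fun h => h1 h.symm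
    simp [h1, h2, h1']
  · simp [h1, h2]

/-- **The four operators are linearly independent.** [folklore] -/
theorem β₀_linearIndependent : LinearIndependent K (β₀ K) := by
  refine Fintype.linearIndependent_iff.mpr fun g hg r => ?_
  have key : ∀ p q : Fin 2, g (p, q) = (∑ r, g r • β₀ K r) (mkLeaf p 0) (mkLeaf q 0) := by
    intro p q
    simp only [Matrix.sum_apply, Matrix.smul_apply, β₀, Matrix.of_apply, side_mkLeaf, row_mkLeaf,
      smul_eq_mul, mul_ite, mul_one, mul_zero, Fintype.sum_prod_type, Fin.sum_univ_two]
    fin_cases p <;> fin_cases q <;> simp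
  obtain ⟨p, q⟩ := r
  rw [key p q, hg]
  rfl

/-! ## A generic point `q ≠ 0, 1`: the commutant is the block scalars -/

/-- Block scalar `1` on side `σ`. [folklore] -/
def P (σ : Fin 2) : Matrix Leaf2 Leaf2 K :=
  Matrix.of fun a d => if a = d ∧ side a = σ then 1 else 0

variable {K}

/-- **The `x`-pencil commutant of `𝔖(q)`, `q ≠ 0, 1`, is `{(μ₀ ⊕ μ₁, μ₀ ⊕ μ₁)}`.**
[cite: BurgisserClausenShokrollahi1997, (15.19), sec. 20.2] -/
theorem comm_fam {q : K} (hq0 : q ≠ 0) (hq1 : q ≠ 1) {β' γ' : Matrix Leaf2 Leaf2 K}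
    (H : ∀ x, β' * slice (fam K q) x = slice (fam K q) x * γ') :
    ∃ μ₀ μ₁ : K, β' = μ₀ • P K 0 + μ₁ • P K 1 ∧ γ' = μ₀ • P K 0 + μ₁ • P K 1 := by
  -- the entry equations
  have E : ∀ a c x, (if row c = x.2 then wS K q (side c) x * β' a (mkLeaf (side c) x.1) else 0) =
      (if row a = x.1 then wS K q (side a) x * γ' (mkLeaf (side a) x.2) c else 0) := by
    intro a c x
    have := congr_fun (congr_fun (H x) a) c
    rwa [mul_slice, slice_mul] at this
  -- (Z) zero pattern off the row-diagonal
  have Zβ : ∀ a d : Leaf2, row a ≠ row d → β' a d = 0 := by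
    intro a d h
    have e := E a d (row d, row d)
    clear E H
    rcases a with ⟨r, l⟩ | ⟨r, l⟩ <;> rcases d with ⟨k, l'⟩ | ⟨k, l'⟩ <;> fin_cases l <;>
      fin_cases l' <;> fin_cases r <;> fin_cases k <;>
      first
        | exact absurd rfl h
        | (simp [side, row, mkLeaf, wS, famW] at e; exact e)
  have Zγ : ∀ d c : Leaf2, row d ≠ row c → γ' d c = 0 := by
    intro d c h
    have e := E d c (row d, row d)
    clear E H
    rcases d with ⟨r, l⟩ | ⟨r, l⟩ <;> rcases c with ⟨k, l'⟩ | ⟨k, l'⟩ <;> fin_cases l <;>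
      fin_cases l' <;> fin_cases r <;> fin_cases k <;>
      first
        | exact absurd rfl h
        | (simp [side, row, mkLeaf, wS, famW] at e; exact e.symm)
  -- (D) diagonal entries
  have d1₀ := E (Sum.inl (0, 0)) (Sum.inl (0, 0)) (0, 0)
  have d1₁ := E (Sum.inr (0, 0)) (Sum.inr (0, 0)) (0, 0)
  have d2₀ := E (Sum.inl (0, 0)) (Sum.inl (1, 0)) (0, 1)
  have d2₁ := E (Sum.inr (0, 0)) (Sum.inr (1, 0)) (0, 1)
  have d3₀ := E (Sum.inl (1, 0)) (Sum.inl (0, 0)) (1, 0)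
  have d3₁ := E (Sum.inr (1, 0)) (Sum.inr (0, 0)) (1, 0)
  -- (C) cross entries: the four-term chains through the weight `q`
  have e00 := E (Sum.inl (0, 0)) (Sum.inr (0, 0)) (0, 0)
  have e01 := E (Sum.inl (0, 0)) (Sum.inr (1, 0)) (0, 1)
  have e11 := E (Sum.inl (1, 0)) (Sum.inr (1, 0)) (1, 1)
  have e10 := E (Sum.inl (1, 0)) (Sum.inr (0, 0)) (1, 0)
  have f00 := E (Sum.inr (0, 0)) (Sum.inl (0, 0)) (0, 0)
  have f01 := E (Sum.inr (0, 0)) (Sum.inl (1, 0)) (0, 1)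
  have f11 := E (Sum.inr (1, 0)) (Sum.inl (1, 0)) (1, 1)
  have f10 := E (Sum.inr (1, 0)) (Sum.inl (0, 0)) (1, 0)
  clear E H
  simp [side, row, mkLeaf, wS, famW, hq0] at d1₀ d1₁ d2₀ d2₁ d3₀ d3₁
  simp [side, row, mkLeaf, wS, famW] at e00 e01 e11 e10 f00 f01 f11 f10
  have hq1' : q - 1 ≠ 0 := sub_ne_zero.mpr hq1
  have cβ1 : β' (Sum.inl (1, 0)) (Sum.inr (1, 0)) = 0 := by
    have : (q - 1) * β' (Sum.inl (1, 0)) (Sum.inr (1, 0)) = 0 := by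
      linear_combination e10 - e00 + e01 - e11
    exact (mul_eq_zero.mp this).resolve_left hq1'
  have cβ0 : β' (Sum.inl (0, 0)) (Sum.inr (0, 0)) = 0 := by linear_combination e01 - e11 + cβ1
  have cγ0 : γ' (Sum.inl (0, 0)) (Sum.inr (0, 0)) = 0 := by linear_combination cβ0 - e00
  have cγ1 : γ' (Sum.inl (1, 0)) (Sum.inr (1, 0)) = 0 := by linear_combination cβ1 - e11
  have cγ0' : γ' (Sum.inr (0, 0)) (Sum.inl (0, 0)) = 0 := by
    have : (q - 1) * γ' (Sum.inr (0, 0)) (Sum.inl (0, 0)) = 0 := by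
      linear_combination f00 - f01 + f11 - f10
    exact (mul_eq_zero.mp this).resolve_left hq1'
  have cβ0' : β' (Sum.inr (0, 0)) (Sum.inl (0, 0)) = 0 := by linear_combination f00 + cγ0'
  have cγ1' : γ' (Sum.inr (1, 0)) (Sum.inl (1, 0)) = 0 := by linear_combination cβ0' - f01
  have cβ1' : β' (Sum.inr (1, 0)) (Sum.inl (1, 0)) = 0 := by linear_combination f11 + cγ1'
  -- diagonal values
  have D1₀ : γ' (Sum.inl (0, 0)) (Sum.inl (0, 0)) = β' (Sum.inl (0, 0)) (Sum.inl (0, 0)) := by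
    linear_combination -d1₀
  have D1₁ : γ' (Sum.inr (0, 0)) (Sum.inr (0, 0)) = β' (Sum.inr (0, 0)) (Sum.inr (0, 0)) := by
    linear_combination -d1₁
  have D2₀ : γ' (Sum.inl (1, 0)) (Sum.inl (1, 0)) = β' (Sum.inl (0, 0)) (Sum.inl (0, 0)) := by
    linear_combination -d2₀
  have D2₁ : γ' (Sum.inr (1, 0)) (Sum.inr (1, 0)) = β' (Sum.inr (0, 0)) (Sum.inr (0, 0)) := by
    linear_combination -d2₁
  have D3₀ : β' (Sum.inl (1, 0)) (Sum.inl (1, 0)) = β' (Sum.inl (0, 0)) (Sum.inl (0, 0)) := by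
    linear_combination d3₀ + D1₀
  have D3₁ : β' (Sum.inr (1, 0)) (Sum.inr (1, 0)) = β' (Sum.inr (0, 0)) (Sum.inr (0, 0)) := by
    linear_combination d3₁ + D1₁
  refine ⟨β' (Sum.inl (0, 0)) (Sum.inl (0, 0)), β' (Sum.inr (0, 0)) (Sum.inr (0, 0)), ?_, ?_⟩
  · ext a d
    rcases a with ⟨r, l⟩ | ⟨r, l⟩ <;> rcases d with ⟨k, l'⟩ | ⟨k, l'⟩ <;> fin_cases l <;>
      fin_cases l' <;> fin_cases r <;> fin_cases k <;>
      simp [P, side, Matrix.add_apply] <;>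
      first
        | exact Zβ _ _ (by decide)
        | assumption
  · ext a d
    rcases a with ⟨r, l⟩ | ⟨r, l⟩ <;> rcases d with ⟨k, l'⟩ | ⟨k, l'⟩ <;> fin_cases l <;>
      fin_cases l' <;> fin_cases r <;> fin_cases k <;>
      simp [P, side, Matrix.add_apply] <;>
      first
        | exact Zγ _ _ (by decide)
        | assumption

/-! ## The theorem -/

variable (K)

/-- The candidate commutant: block scalars, as the range of a linear map from `K²`. [folklore] -/
def blockScalars : Submodule K (Matrix Leaf2 Leaf2 K × Matrix Leaf2 Leaf2 K) :=
  LinearMap.range (Fintype.linearCombination K (fun σ : Fin 2 => (P K σ, P K σ)))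

/-- `dim blockScalars ≤ 2`. [folklore] -/
theorem finrank_blockScalars_le : Module.finrank K (blockScalars K) ≤ 2 :=
  (LinearMap.finrank_range_le _).trans (by simp)

/-- **`𝔖(1) ⋭ 𝔖(q)` for `q ≠ 0, 1`, every field.**
[cite: BurgisserClausenShokrollahi1997, (15.19)] -/
theorem fam_one_not_algDegeneratesTo_fam {q : K} (hq0 : q ≠ 0) (hq1 : q ≠ 1) :
    ¬ AlgDegeneratesTo (fam K 1) (fam K q) := by
  refine not_algDegeneratesTo_of_commutant (R₀ := Fin 2 × Fin 2) (fam K 1) (fam K q)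
    (β₀ K) (β₀ K) (hcomm₀ K) (β₀_linearIndependent K) (blockScalars K) ?_ ?_
  · intro β' γ' H
    obtain ⟨μ₀, μ₁, rfl, rfl⟩ := comm_fam hq0 hq1 H
    refine ⟨fun σ => if σ = 0 then μ₀ else μ₁, ?_⟩
    rw [Fintype.linearCombination_apply, Fin.sum_univ_two]
    simp
  · calc Module.finrank K (blockScalars K) ≤ 2 := finrank_blockScalars_le K
      _ < Fintype.card (Fin 2 × Fin 2) := by simp

/-- **`⟨2,2,2⟩ ⋭ 𝔖(q)` for every `q ∉ {0,1}`, over every field**: the one-parameter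
same-support family is unreachable from matrix multiplication except at the coherent point.
[cite: BurgisserClausenShokrollahi1997, (15.19)] [cite: BlaserChristandlZuiddam2017, §2] -/
theorem matMul_not_algDegeneratesTo_fam {q : K} (hq0 : q ≠ 0) (hq1 : q ≠ 1) :
    ¬ AlgDegeneratesTo (matMulTensor K 2 2 (1 + 1)) (fam K q) := fun h =>
  fam_one_not_algDegeneratesTo_fam K hq0 hq1
    (by rw [fam_one]; exact (permStar_restrictsTo_matMul IsProdPerm.refl).algDegeneratesTo_trans h)

/-- The point `q = -1`: **`⟨2,2,2⟩ ⋭ 𝔖^♭`** as soon as `-1 ≠ 1` (characteristic `≠ 2`; finite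
fields allowed), without the permutation model. [cite: BurgisserClausenShokrollahi1997, (15.19)] -/
theorem matMul_not_algDegeneratesTo_signStar_of_two_ne_zero (h2 : (2 : K) ≠ 0) :
    ¬ AlgDegeneratesTo (matMulTensor K 2 2 (1 + 1)) (signStar K) := by
  rw [← fam_neg_one]
  refine matMul_not_algDegeneratesTo_fam K (neg_ne_zero.mpr one_ne_zero) fun h => h2 ?_
  linear_combination -h

end Summit.MatrixMultiplication.MatrixMultiplication.Theorems.FarEdgeDescentWeightFamily

end
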